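import Summits.Ventures.DiscreteObjects.Hadamard.NonCyclicLP333Lattice

/-!
# Hadamard 668 census, family F5c — the row-sum obstruction for the diagonal class K14 = ⟨(x,y,j) ↦ (x+y, y, 8j)⟩

Framing: lottery ticket; floor = certified bounds/negative ranges.

Cell pub-namedobj (venture DiscreteObjects), target (H), gen 3; third file of the F5c series (`NonCyclicLP333.lean`,
`NonCyclicLP333Lattice.lean`).  Class K14 of FAMILY-F5C.md (order 12; cyclic analogues: arXiv:2607.20765 Table A1 rows 17, 18,
"row-sum mod 24") is the one exact-obstruction class not covered by the `τ`, `j ↦ 4j`, `j ↦ 8j` and quotient lemmas.  For an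
array `a` invariant under `g : (x, y, j) ↦ (x + y, y, 8j)`: `g³ = (j ↦ 31j)` makes every `Z₃₇`-compression entry
`e(v) = a(v,0) + 4·(nine signs)`; `g` itself ties `e(x+1, 1) = e(x, 1)` and `e(x+2, 2) = e(x, 2)`; and on the plane `y = 0`,
where `g` acts as `j ↦ 8j`, `e(x, 0) = a(x,0,0) + 12·(three signs)`.  Hence
`Σ a = Σ_x e(x,0) + 3 e(0,1) + 3 e(0,2) = S + 12·(odd)` with `|S| ≤ 9`, so `Σ a ≠ ±1` — but the arrays of a Legendre pair have
row sums `±1` (`rowsum_sq_on`).  Main statement `no_legendrePairOn_G333_K14` (ours).  With this file every F5c class that dies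
by an exact obstruction (13 classes) and K15/K19 have kernel theorems; K05, K06, K08, K11 rest on the two-implementation sieve and
K09 on the hand proof of FAMILY-F5C.md §10.  No `sorry`, no `native_decide`.
-/

namespace Summit.Ventures.DiscreteObjects.Hadamard

open Finset BigOperators
open Literature.Combinatorics.Designs.LegendrePairs (PAFOn IsPMOn LegendrePairOn rowsum_sq_on pm_of_sq)

/-- `ZMod 37 = {0} ∪ ⋃_{i<9} 2^i·{1, 31, 36, 6}` (`⟨31⟩` is the subgroup of order 4; `2` generates the quotient of order 9). -/
lemma sum_Z37_split31 (f : ZMod 37 → ℤ) :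
    ∑ j, f j = f 0 + ∑ p : Fin 9 × Fin 4, f (2 ^ (p.1 : ℕ) * 31 ^ (p.2 : ℕ)) := by
  have hU : (Finset.univ : Finset (ZMod 37)) =
      {0} ∪ (Finset.univ.image fun p : Fin 9 × Fin 4 => (2 : ZMod 37) ^ (p.1 : ℕ) * 31 ^ (p.2 : ℕ)) := by decide
  have hd : Disjoint ({0} : Finset (ZMod 37))
      (Finset.univ.image fun p : Fin 9 × Fin 4 => (2 : ZMod 37) ^ (p.1 : ℕ) * 31 ^ (p.2 : ℕ)) := by decide
  have hi : Function.Injective fun p : Fin 9 × Fin 4 => (2 : ZMod 37) ^ (p.1 : ℕ) * 31 ^ (p.2 : ℕ) := by decide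
  rw [hU, Finset.sum_union hd, Finset.sum_singleton, Finset.sum_image (fun x _ y _ h => hi h)]

/-- fibrewise: invariance under `j ↦ 31j` on the fibre over `v` gives `e(v) = a(v,0) + 4 Σ_{i<9} a(v, 2^i)`. -/
lemma comp37_inv31_at (c : G333 → ℤ) (v : ZMod 3 × ZMod 3) (hc : ∀ j, c (v, 31 * j) = c (v, j)) :
    comp37 c v = c (v, 0) + 4 * ∑ i : Fin 9, c (v, 2 ^ (i : ℕ)) := by
  unfold comp37
  rw [sum_Z37_split31, Fintype.sum_prod_type]
  have hk : ∀ (i : Fin 9) (k : ℕ), c (v, 2 ^ (i : ℕ) * 31 ^ k) = c (v, 2 ^ (i : ℕ)) := by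
    intro i k
    induction k with
    | zero => simp
    | succ k ih => rw [pow_succ, ← mul_assoc, mul_comm _ (31 : ZMod 37), hc, ih]
  congr 1
  rw [Finset.mul_sum]
  refine Finset.sum_congr rfl fun i _ => ?_
  simp only [hk, Finset.sum_const, Finset.card_univ, Fintype.card_fin]
  norm_num

/-- fibrewise: invariance under `j ↦ 8j` on the fibre over `v` gives `e(v) = a(v,0) + 12 (a(v,1) + a(v,2) + a(v,4))`. -/
lemma comp37_inv8_at (c : G333 → ℤ) (v : ZMod 3 × ZMod 3) (hc : ∀ j, c (v, 8 * j) = c (v, j)) :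
    comp37 c v = c (v, 0) + 12 * (c (v, 1) + c (v, 2) + c (v, 4)) := by
  unfold comp37
  rw [sum_Z37_split8]
  have hk : ∀ (j₀ : ZMod 37) (k : ℕ), c (v, 8 ^ k * j₀) = c (v, j₀) := by
    intro j₀ k
    induction k with
    | zero => simp
    | succ k ih => rw [pow_succ, mul_comm (8 ^ k : ZMod 37) 8, mul_assoc, hc, ih]
  have h1 : ∀ k : Fin 12, c (v, 8 ^ (k : ℕ)) = c (v, 1) := fun k => by
    have := hk 1 k; rwa [mul_one] at this
  have h2 : ∀ k : Fin 12, c (v, 2 * 8 ^ (k : ℕ)) = c (v, 2) := fun k => by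
    have := hk 2 k; rwa [mul_comm] at this
  have h4 : ∀ k : Fin 12, c (v, 4 * 8 ^ (k : ℕ)) = c (v, 4) := fun k => by
    have := hk 4 k; rwa [mul_comm] at this
  simp only [h1, h2, h4, Finset.sum_const, Finset.card_univ, Fintype.card_fin]
  ring

/-- consequences of `g`-invariance, `g = (x,y,j) ↦ (x+y, y, 8j)`: `g³ = (j ↦ 31 j)`, on `y = 0` `g = (j ↦ 8j)`, and the
compression is `g`-invariant: `e(x + y, y) = e(x, y)`. -/
lemma K14_facts (c : G333 → ℤ) (hc : ∀ x y j, c ((x + y, y), 8 * j) = c ((x, y), j)) :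
    (∀ v j, c (v, 31 * j) = c (v, j)) ∧ (∀ x j, c ((x, 0), 8 * j) = c ((x, 0), j)) ∧
    (∀ x y, comp37 c (x + y, y) = comp37 c (x, y)) := by
  refine ⟨?_, ?_, ?_⟩
  · rintro ⟨x, y⟩ j
    have h3 := hc (x + y + y) y (8 * (8 * j))
    have h2 := hc (x + y) y (8 * j)
    have h1 := hc x y j
    have three : ∀ z : ZMod 3, z + z + z = 0 := by decide
    have ey : x + y + y + y = x := by
      calc x + y + y + y = x + (y + y + y) := by ring
        _ = x := by rw [three y, add_zero]
    have h512 : (8 : ZMod 37) * (8 * 8) = 31 := by decide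
    have ej : (8 : ZMod 37) * (8 * (8 * j)) = 31 * j := by
      calc (8 : ZMod 37) * (8 * (8 * j)) = (8 * (8 * 8)) * j := by ring
        _ = 31 * j := by rw [h512]
    rw [ey, ej] at h3
    rw [h3, h2, h1]
  · intro x j
    have := hc x 0 j
    rwa [add_zero] at this
  · intro x y
    unfold comp37
    have hu : IsUnit (8 : ZMod 37) := by decide
    rw [← Equiv.sum_comp (hu.unit.mulLeft) (fun j => c ((x + y, y), j))]
    refine Finset.sum_congr rfl fun j _ => ?_
    simp only [Units.mulLeft_apply, IsUnit.unit_spec]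
    exact hc x y j

set_option maxRecDepth 65536 in
/-- the row sum of a `±1` array invariant under `(x,y,j) ↦ (x+y, y, 8j)` is `≠ ±1`. -/
theorem rowsum_ne_of_K14 (c : G333 → ℤ) (hpm : IsPMOn c) (hc : ∀ x y j, c ((x + y, y), 8 * j) = c ((x, y), j)) :
    (∑ h, c h) ≠ 1 ∧ (∑ h, c h) ≠ -1 := by
  obtain ⟨h31, h8, htie⟩ := K14_facts c hc
  -- Σ_h c h = Σ_v e(v) = Σ_x e(x,0) + Σ_x e(x,1) + Σ_x e(x,2), written out over the nine fibres
  have hsplit : ∑ h, c h = ∑ v, comp37 c v := by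
    unfold comp37; rw [Fintype.sum_prod_type]
  have hnine : ∑ v, comp37 c v = comp37 c (0,0) + comp37 c (1,0) + comp37 c (2,0)
      + (comp37 c (0,1) + comp37 c (1,1) + comp37 c (2,1)) + (comp37 c (0,2) + comp37 c (1,2) + comp37 c (2,2)) := by
    rw [Fintype.sum_prod_type]
    simp only [show (Finset.univ : Finset (ZMod 3)) = {0, 1, 2} from by decide,
      Finset.sum_insert (show (0 : ZMod 3) ∉ ({1, 2} : Finset (ZMod 3)) by decide),
      Finset.sum_insert (show (1 : ZMod 3) ∉ ({2} : Finset (ZMod 3)) by decide), Finset.sum_singleton]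
    ring
  -- ties on the planes y = 1, 2
  have t11 : comp37 c (1, 1) = comp37 c (0, 1) := by have := htie 0 1; rwa [zero_add] at this
  have t21 : comp37 c (2, 1) = comp37 c (0, 1) := by
    have := htie 1 1; rw [show (1 : ZMod 3) + 1 = 2 by decide] at this; rw [this, t11]
  have t22 : comp37 c (2, 2) = comp37 c (0, 2) := by have := htie 0 2; rwa [zero_add] at this
  have t12 : comp37 c (1, 2) = comp37 c (0, 2) := by
    have := htie 2 2; rw [show (2 : ZMod 3) + 2 = 1 by decide] at this; rw [this, t22]
  -- fibre formulas
  have e0 : ∀ x : ZMod 3, comp37 c (x, 0) = c ((x, 0), 0) + 12 * (c ((x, 0), 1) + c ((x, 0), 2) + c ((x, 0), 4)) :=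
    fun x => comp37_inv8_at c (x, 0) (h8 x)
  have e1 : ∀ v : ZMod 3 × ZMod 3, comp37 c v = c (v, 0) + 4 * ∑ i : Fin 9, c (v, 2 ^ (i : ℕ)) :=
    fun v => comp37_inv31_at c v (h31 v)
  -- parity bookkeeping: every sign is 2m + 1
  let m : G333 → ℤ := fun h => if c h = 1 then 0 else -1
  have hm : ∀ h, c h = 2 * m h + 1 := fun h => by rcases hpm h with e | e <;> simp [m, e]
  have hb : ∀ h, -1 ≤ c h ∧ c h ≤ 1 := fun h => by rcases hpm h with e | e <;> rw [e] <;> norm_num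
  have s9 : ∀ v : ZMod 3 × ZMod 3, ∑ i : Fin 9, c (v, 2 ^ (i : ℕ)) = 2 * ∑ i : Fin 9, m (v, 2 ^ (i : ℕ)) + 9 := by
    intro v
    rw [Finset.sum_congr rfl (fun (i : Fin 9) _ => hm (v, 2 ^ (i : ℕ))), Finset.sum_add_distrib, ← Finset.mul_sum]
    simp
  rw [hsplit, hnine, t11, t21, t22, t12, e0 0, e0 1, e0 2, e1 (0, 1), e1 (0, 2), s9, s9,
    hm ((0,0),1), hm ((0,0),2), hm ((0,0),4), hm ((1,0),1), hm ((1,0),2), hm ((1,0),4), hm ((2,0),1), hm ((2,0),2), hm ((2,0),4)]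
  have b1 := hb ((0,0),0); have b2 := hb ((1,0),0); have b3 := hb ((2,0),0); have b4 := hb ((0,1),0); have b5 := hb ((0,2),0)
  constructor <;> intro h <;> omega

/-- **Family F5c, class K14: NONE.**  No Legendre pair over `G333` has an array invariant under `(x, y, j) ↦ (x + y, y, 8j)`
(ours; cyclic analogues: arXiv:2607.20765 Table A1 rows 17 and 18). -/
theorem no_legendrePairOn_G333_K14 (a b : G333 → ℤ) (ha : ∀ x y j, a ((x + y, y), 8 * j) = a ((x, y), j)) :
    ¬ LegendrePairOn a b := by
  intro hL
  rcases pm_of_sq _ _ (rowsum_sq_on a b hL) with h1 | h1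
  · exact (rowsum_ne_of_K14 a hL.1 ha).1 h1
  · exact (rowsum_ne_of_K14 a hL.1 ha).2 h1

end Summit.Ventures.DiscreteObjects.Hadamard
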